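import Summits.Ventures.CertifiedManyBodySolver.Observables.EtaPairingExclusionA0prime
import Literature.MathematicalPhysics.QuantumLattice.HubbardTTPrimeHartreeFockCeiling
import Literature.MathematicalPhysics.QuantumLattice.HubbardSquareFreeFermionEnergyDensity
import Literature.MathematicalPhysics.QuantumLattice.HubbardOneBodyKinematicRows
import Literature.MathematicalPhysics.QuantumLattice.HubbardFermiSeaTangentRowsQuarterFilling
import HarnessLib

/-!
# η-PAIRING ODLRO IS EXCLUDED BELOW QUARTER FILLING AT EVERY REPULSION — and in explicit weak-coupling
# windows above it — from ONE-BODY inputs only (no certified row): the paramagnetic Hartree–Fock ceiling at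
# half filling and the Lieb–Loss bathtub / kernel Fermi-sea floors

HONEST FRAMING: exclusions in Yang's staggered `s`-wave (η) pair channel (`Q = (π,π)` on-site pairs) — where nobody expects
order; NOTHING about `d`-wave pairing or the uniform on-site channel; CTL/dictionary class; a ceiling never speaks to presence;
not a superconductivity verdict; no phase sentence. Crew hubbard-obs (D-0042), seat hubbard-obs-p1 (`prover-hubbard-obs-p1-g15-0`);
continuation of `EtaPairingExclusionA0prime` (g13: the lever and the §1 GENERIC CELL FORM `…_of_chemPotPlus_le/_lt`) and
`EtaPairingExclusionGridCells[OddU]` (g14: certified cells). ZERO compute; no definition; no `sorry`; every number is a literal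
of a tree THEOREM (kernel Fermi-sea rows) plus exact arithmetic (`norm_num`); NO claim node enters this file.

THE OBSERVATION. The lever needs `2μ₊(n; U) < U`. Convexity of `m ↦ e(1,0,U,m)` gives the secant
`μ₊(n) ≤ (e(U,1) − e(U,n))/(1 − n)` (`chemPotPlusTT'_le_of_bounds_halfFilling2D`); the paramagnetic Hartree–Fock CEILING at half
filling `e(U,1) ≤ e_free(1) + U/4 = −16/π² + U/4` (`TTPrimeFree.energyDensityTT'_one_le_free_add`,
`FreeFermionSquare.energyDensity2D_one_zero_one`) and ANY floor `ℓ ≤ e(U,n)` give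
    `U − 2μ₊(n; U) ≥ (U(1 − 2n) + 4(ℓ + 16/π²)) / (2(1 − n))`.
* With the Lieb–Loss bathtub floor `ℓ = −16/π²` (`neg_sixteen_mul_abs_div_pi_sq_le_energyDensityTT'`, every density):
  `U − 2μ₊ ≥ U(1 − 2n)/(2(1 − n)) > 0` for EVERY `U > 0` and EVERY `0 < n < 1/2` — the repulsion enters the half-filling ceiling
  with coefficient `1/4` but a binding secant would need `(1 − n)/2 > 1/4` (§2, table-free).
* With the kernel Fermi-sea row at quarter filling (`HubbardFermiSeaTangentRowsQuarterFilling`, `M = 64`, uniform in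
  `U ≥ 0`): at `n = 1/2` the `U`-terms cancel and `U − 2μ₊ ≥ 1.2251963` for EVERY `U ≥ 0` (§3). Above quarter filling the
  free compressibility gain `g(n) = ℓ(n) + 16/π² > 0` buys WEAK-COUPLING windows `U < 4g(n)/(2n − 1)` — typed, with the
  two small-`U` atlas cells `(1/32, 7/8, 0)` / `(1/8, 7/8, 0)`, in the companion file `EtaPairingExclusionWeakCouplingWindows`
  through the generic window form `etaPairing_exclusion_of_floor` of §1.
In each case the §1 generic cell form of `EtaPairingExclusionA0prime` yields, for every translation-invariant ground state `ω`
of density `n` (in particular every torus limit of unit sector ground states, the cell's row class): NO η-pairing ODLRO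
`M⁻⁴ Re ω(η†_{Λ_M} η_{Λ_M}) → 0`, the local bound `Re ω(η†_Λ η_Λ) ≤ 64(|Λ'| − |Λ|)²/margin²` (`Λ' ⊇ thicken Λ 1`) and the
box structure-factor bound `M⁻² Re ω(η†η) ≤ 4096/margin²`.

WHAT IT IS NOT. A Mott gap at half filling (`μ₋(1) < U/2`, unproved in `d = 2`) would give `2μ₊(n) ≤ 2μ₋(1) < U` at EVERY
`n < 1`; this file proves only what one-body inputs certify. Above half filling the lever as typed (`2μ < U`, stability tested
on `η_Λ`) does not apply; the particle–hole mirror `n ↦ 2 − n` is not typed here. `t' = 0` throughout (η is an exact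
eigen-operator of `ad(H − μN)` only for bipartite hopping).

CITATION FORM (obs-lit g10 / p1 g13 presearch 2026-08-27, corpus + galaxy; p1 g15 presearch 2026-08-27: "eta pairing" ×
"quarter filling" / "low density" / "absence of long-range order" — corpus + galaxy, no printed infinite-volume statement):
[folklore: Yang 1989 commutator + Bratteli–Robinson ground-state stability; finite-volume precedent Yang–Zhang 1990 Thm. 11]
— the `[cite:]` tags name the INGREDIENTS each declaration rests on. References: C. N. Yang, PRL 63 (1989) 2144, eqs. (6)–(8)
[Yang1989]; O. Bratteli, D. W. Robinson, OAQSM 2 (1997) Prop. 5.3.19 [BratteliRobinsonII1997]; V. Bach, E. H. Lieb,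
J. P. Solovej, J. Stat. Phys. 76 (1994) 3, eq. (2c.36) [BachLiebSolovej1994]; E. H. Lieb, M. Loss, Duke Math. J. 71 (1993)
337, §8 Thm 8.2 [LiebLoss1993]; E. H. Lieb, F. Y. Wu, Physica A 321 (2003) 1, §7 [LiebWuPhysicaA2003].
-/

noncomputable section

namespace Summit.Ventures.CertifiedManyBodySolver.Observables

open Matrix Finset Filter Literature.MathematicalPhysics.QuantumLattice Literature.Probability.LatticeModels
open Literature.MathematicalPhysics.QuantumLattice.HubbardWave0 ThermodynamicLimit
open Summit.Ventures.CertifiedManyBodySolver.Certificates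
open scoped ComplexOrder Topology

/-! ### §1 The one-body secant: `U − 2μ₊(n;U) ≥ (U(1−2n) + 4(ℓ + 16/π²))/(2(1−n))` for any floor `ℓ ≤ e(U,n)` -/

/-- **Paramagnetic Hartree–Fock ceiling at half filling, closed form**: `e(1, U, 1) ≤ −16/π² + U/4` (`U ≥ 0`) — the
half-filled plane-wave Slater determinant. [cite: BachLiebSolovej1994, eq. (2c.36)] -/
theorem energyDensity2D_one_le_neg_sixteen_div_pi_sq_add (U : ℝ) (hU : 0 ≤ U) :
    energyDensity2D 1 U 1 ≤ -16 / Real.pi ^ 2 + U / 4 := by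
  have h := TTPrimeFree.energyDensityTT'_one_le_free_add 1 0 hU
  rw [energyDensityTT'_zero, energyDensityTT'_zero, FreeFermionSquare.energyDensity2D_one_zero_one] at h
  exact h

/-- Numerical enclosure used below: `1.6211389 < 16/π²` (`π < 3.14159265358979323847`). [folklore] -/
theorem sixteen_div_pi_sq_gt_decimal : (1.6211389 : ℝ) < 16 / Real.pi ^ 2 := by
  have hπ : Real.pi < 3.14159265358979323847 := Real.pi_lt_d20
  have hpos : (0 : ℝ) < Real.pi ^ 2 := by positivity
  have hsq : Real.pi ^ 2 < (9.8696044011 : ℝ) := by nlinarith [Real.pi_pos]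
  rw [lt_div_iff₀ hpos]
  nlinarith

/-- **THE ONE-BODY SECANT.** For `U ≥ 0`, `0 < n < 1` and any floor `ℓ ≤ e(1,0,U,n)`:
`U − 2μ₊(n; U) ≥ (U(1 − 2n) + 4(ℓ + 16/π²))/(2(1 − n))` — convexity secant over `[n, 1]` with the Hartree–Fock ceiling
`−16/π² + U/4` at half filling. [cite: LiebWuPhysicaA2003, §7] [cite: BachLiebSolovej1994, eq. (2c.36)] -/
theorem sub_two_mul_chemPotPlusTT'_ge_of_floor {U n ℓ : ℝ} (hU : 0 ≤ U) (hn0 : 0 < n) (hn1 : n < 1)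
    (hℓ : ℓ ≤ energyDensityTT' 1 0 U n) :
    (U * (1 - 2 * n) + 4 * (ℓ + 16 / Real.pi ^ 2)) / (2 * (1 - n)) ≤ U - 2 * chemPotPlusTT' 1 0 U n := by
  have hhi := energyDensity2D_one_le_neg_sixteen_div_pi_sq_add U hU
  have h := chemPotPlusTT'_le_of_bounds_halfFilling2D 1 0 hU hn0 hn1 hℓ hhi
  have h1n : 0 < 1 - n := by linarith
  have h2 : 2 * chemPotPlusTT' 1 0 U n ≤ 2 * ((-16 / Real.pi ^ 2 + U / 4 - ℓ) / (1 - n)) := by linarith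
  have key : (U * (1 - 2 * n) + 4 * (ℓ + 16 / Real.pi ^ 2)) / (2 * (1 - n)) =
      U - 2 * ((-16 / Real.pi ^ 2 + U / 4 - ℓ) / (1 - n)) := by
    field_simp
    ring
  linarith

/-- **The secant in decimal form**: `U − 2μ₊(n; U) ≥ (U(1 − 2n) + 4(ℓ + 1.6211389))/(2(1 − n))` (`16/π² > 1.6211389`).
[cite: LiebWuPhysicaA2003, §7] -/
theorem sub_two_mul_chemPotPlusTT'_ge_of_floor_decimal {U n ℓ : ℝ} (hU : 0 ≤ U) (hn0 : 0 < n) (hn1 : n < 1)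
    (hℓ : ℓ ≤ energyDensityTT' 1 0 U n) :
    (U * (1 - 2 * n) + 4 * (ℓ + 1.6211389)) / (2 * (1 - n)) ≤ U - 2 * chemPotPlusTT' 1 0 U n := by
  have h := sub_two_mul_chemPotPlusTT'_ge_of_floor hU hn0 hn1 hℓ
  have hπ := sixteen_div_pi_sq_gt_decimal
  have h1n : 0 < 2 * (1 - n) := by linarith
  refine le_trans ?_ h
  exact div_le_div_of_nonneg_right (by linarith) h1n.le

/-- **Table-free form (bathtub floor `ℓ = −16/π²`)**: `U − 2μ₊(n; U) ≥ U(1 − 2n)/(2(1 − n))` for `U ≥ 0`, `0 < n < 1`.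
[cite: LiebLoss1993, §8, Theorem 8.2] [cite: LiebWuPhysicaA2003, §7] -/
theorem sub_two_mul_chemPotPlusTT'_ge_bathtub {U n : ℝ} (hU : 0 ≤ U) (hn0 : 0 < n) (hn1 : n < 1) :
    U * (1 - 2 * n) / (2 * (1 - n)) ≤ U - 2 * chemPotPlusTT' 1 0 U n := by
  have hℓ : -16 / Real.pi ^ 2 ≤ energyDensityTT' 1 0 U n := by
    have h := neg_sixteen_mul_abs_div_pi_sq_le_energyDensityTT' 1 hU hn0.le (by linarith)
    simpa using h
  have h := sub_two_mul_chemPotPlusTT'_ge_of_floor hU hn0 hn1 hℓ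
  have e : U * (1 - 2 * n) + 4 * (-16 / Real.pi ^ 2 + 16 / Real.pi ^ 2) = U * (1 - 2 * n) := by ring
  rwa [e] at h

/-- **GENERIC WINDOW FORM of the exclusion** (packages the §1 secant with the §1 generic cell form of
`EtaPairingExclusionA0prime`): at `(U, n, 0)`, `U ≥ 0`, `0 < n < 1`, a floor `ℓ ≤ e(1,0,U,n)` with POSITIVE margin
`m := (U(1 − 2n) + 4(ℓ + 1.6211389))/(2(1 − n)) > 0` excludes η-pairing ODLRO in every translation-invariant ground state
of density `n`: `M⁻⁴ Re ω(η†η) → 0` and `Re ω(η†_Λ η_Λ) ≤ 64(|Λ'| − |Λ|)²/m²`. [cite: Yang1989, eqs. (6)–(8)]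
[cite: BratteliRobinsonII1997, Prop. 5.3.19] -/
theorem etaPairing_exclusion_of_floor {U n ℓ : ℝ} (hU : 0 ≤ U) (hn0 : 0 < n) (hn1 : n < 1)
    (hℓ : ℓ ≤ energyDensityTT' 1 0 U n) (hm : 0 < U * (1 - 2 * n) + 4 * (ℓ + 1.6211389))
    {ω : InfVolFermionState 2} (hω : ω.IsTranslationInvariant) (hρ : ω.density = n)
    (hme : ω.meanEnergy (hubbardTTPrimeFermionInteraction 1 0 U) 1 = energyDensityTT' 1 0 U n) :
    Tendsto (fun M : ℕ =>
        (ω.expect (halfOpenBox 2 M) (etaRaise (fun w : PolySite (halfOpenBox 2 M) => siteStagger (ofLex w.1)) *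
          etaLower (fun w : PolySite (halfOpenBox 2 M) => siteStagger (ofLex w.1)))).re / (M : ℝ) ^ 4)
        atTop (𝓝 0) ∧
      ∀ {Λ Λ' : Finset (Site 2)}, Λ ⊆ Λ' → thicken Λ 1 ⊆ Λ' →
        (ω.expect Λ (etaRaise (fun w : PolySite Λ => siteStagger (ofLex w.1)) *
            etaLower (fun w : PolySite Λ => siteStagger (ofLex w.1)))).re ≤
          64 * ((#Λ' : ℝ) - #Λ) ^ 2 / ((U * (1 - 2 * n) + 4 * (ℓ + 1.6211389)) / (2 * (1 - n))) ^ 2 := by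
  have hgap := sub_two_mul_chemPotPlusTT'_ge_of_floor_decimal hU hn0 hn1 hℓ
  have h1n : 0 < 2 * (1 - n) := by linarith
  have hmpos : 0 < (U * (1 - 2 * n) + 4 * (ℓ + 1.6211389)) / (2 * (1 - n)) := div_pos hm h1n
  have hn2 : n < 2 := by linarith
  refine ⟨tendsto_etaPairing_boxLRO_of_chemPotPlus_lt hU hn0 hn2 (by linarith) hω hρ hme, fun hΛ h8 => ?_⟩
  have h := re_expect_etaRaise_mul_etaLower_le_of_chemPotPlus_le (U := U) (n := n)
    (m := chemPotPlusTT' 1 0 U n) hU hn0 hn2 le_rfl (by linarith) hω hρ hme hΛ h8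
  refine h.trans (div_le_div_of_nonneg_left (by positivity) (by positivity) ?_)
  exact pow_le_pow_left₀ hmpos.le hgap 2

/-- **GENERIC WINDOW FORM, structure factor**: under the same hypotheses `M⁻² Re ω(η†_{Λ_M} η_{Λ_M}) ≤ 4096/m²` (`M ≥ 1`).
[cite: Yang1989, eq. (6)] [cite: BratteliRobinsonII1997, Prop. 5.3.19] -/
theorem etaPairing_boxStructureFactor_le_of_floor {U n ℓ : ℝ} (hU : 0 ≤ U) (hn0 : 0 < n) (hn1 : n < 1)
    (hℓ : ℓ ≤ energyDensityTT' 1 0 U n) (hm : 0 < U * (1 - 2 * n) + 4 * (ℓ + 1.6211389))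
    {ω : InfVolFermionState 2} (hω : ω.IsTranslationInvariant) (hρ : ω.density = n)
    (hme : ω.meanEnergy (hubbardTTPrimeFermionInteraction 1 0 U) 1 = energyDensityTT' 1 0 U n)
    {M : ℕ} (hM : 1 ≤ M) :
    (ω.expect (halfOpenBox 2 M) (etaRaise (fun w : PolySite (halfOpenBox 2 M) => siteStagger (ofLex w.1)) *
        etaLower (fun w : PolySite (halfOpenBox 2 M) => siteStagger (ofLex w.1)))).re / (M : ℝ) ^ 2 ≤
      4096 / ((U * (1 - 2 * n) + 4 * (ℓ + 1.6211389)) / (2 * (1 - n))) ^ 2 := by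
  have hgap := sub_two_mul_chemPotPlusTT'_ge_of_floor_decimal hU hn0 hn1 hℓ
  have h1n : 0 < 2 * (1 - n) := by linarith
  have hmpos : 0 < (U * (1 - 2 * n) + 4 * (ℓ + 1.6211389)) / (2 * (1 - n)) := div_pos hm h1n
  have hn2 : n < 2 := by linarith
  have h := etaPairing_boxStructureFactor_le_of_chemPotPlus_le (U := U) (n := n)
    (m := chemPotPlusTT' 1 0 U n) hU hn0 hn2 le_rfl (by linarith) hω hρ hme hM
  refine h.trans (div_le_div_of_nonneg_left (by norm_num) (by positivity) ?_)
  exact pow_le_pow_left₀ hmpos.le hgap 2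

/-! ### §2 BELOW QUARTER FILLING: every `U > 0`, every `0 < n < 1/2` — table-free -/

/-- **η-PAIRING ODLRO IS ABSENT BELOW QUARTER FILLING AT EVERY REPULSION.** For the `t' = 0` square-lattice Hubbard
model with ANY `U > 0` and ANY density `0 < n < 1/2`, every translation-invariant ground state `ω` of density `n` has
`M⁻⁴ Re ω(η†_{Λ_M} η_{Λ_M}) → 0` and `Re ω(η†_Λ η_Λ) ≤ 64(|Λ'| − |Λ|)² / (U(1 − 2n)/(2(1 − n)))²` (`Λ' ⊇ thicken Λ 1`).
Inputs: Yang's commutator, Bratteli–Robinson stability, the bathtub floor and the Hartree–Fock half-filling ceiling — no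
certified row, no kernel table. [cite: Yang1989, eqs. (6)–(8)] [cite: BratteliRobinsonII1997, Prop. 5.3.19]
[cite: LiebLoss1993, §8, Theorem 8.2] [cite: BachLiebSolovej1994, eq. (2c.36)] -/
theorem etaPairing_exclusion_of_lt_quarterFilling {U n : ℝ} (hU : 0 < U) (hn0 : 0 < n) (hn : n < 1 / 2)
    {ω : InfVolFermionState 2} (hω : ω.IsTranslationInvariant) (hρ : ω.density = n)
    (hme : ω.meanEnergy (hubbardTTPrimeFermionInteraction 1 0 U) 1 = energyDensityTT' 1 0 U n) :
    Tendsto (fun M : ℕ =>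
        (ω.expect (halfOpenBox 2 M) (etaRaise (fun w : PolySite (halfOpenBox 2 M) => siteStagger (ofLex w.1)) *
          etaLower (fun w : PolySite (halfOpenBox 2 M) => siteStagger (ofLex w.1)))).re / (M : ℝ) ^ 4)
        atTop (𝓝 0) ∧
      ∀ {Λ Λ' : Finset (Site 2)}, Λ ⊆ Λ' → thicken Λ 1 ⊆ Λ' →
        (ω.expect Λ (etaRaise (fun w : PolySite Λ => siteStagger (ofLex w.1)) *
            etaLower (fun w : PolySite Λ => siteStagger (ofLex w.1)))).re ≤
          64 * ((#Λ' : ℝ) - #Λ) ^ 2 / (U * (1 - 2 * n) / (2 * (1 - n))) ^ 2 := by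
  have hn1 : n < 1 := by linarith
  have hn2 : n < 2 := by linarith
  have hgap := sub_two_mul_chemPotPlusTT'_ge_bathtub hU.le hn0 hn1
  have h1n : 0 < 2 * (1 - n) := by linarith
  have hmpos : 0 < U * (1 - 2 * n) / (2 * (1 - n)) := div_pos (mul_pos hU (by linarith)) h1n
  refine ⟨tendsto_etaPairing_boxLRO_of_chemPotPlus_lt hU.le hn0 hn2 (by linarith) hω hρ hme, fun hΛ h8 => ?_⟩
  have h := re_expect_etaRaise_mul_etaLower_le_of_chemPotPlus_le (U := U) (n := n)
    (m := chemPotPlusTT' 1 0 U n) hU.le hn0 hn2 le_rfl (by linarith) hω hρ hme hΛ h8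
  refine h.trans (div_le_div_of_nonneg_left (by positivity) (by positivity) ?_)
  exact pow_le_pow_left₀ hmpos.le hgap 2

/-- **Below quarter filling, structure factor**: `M⁻² Re ω(η†_{Λ_M} η_{Λ_M}) ≤ 4096 / (U(1 − 2n)/(2(1 − n)))²` (`M ≥ 1`;
`U > 0`, `0 < n < 1/2`). [cite: Yang1989, eq. (6)] [cite: BratteliRobinsonII1997, Prop. 5.3.19] -/
theorem etaPairing_boxStructureFactor_le_of_lt_quarterFilling {U n : ℝ} (hU : 0 < U) (hn0 : 0 < n) (hn : n < 1 / 2)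
    {ω : InfVolFermionState 2} (hω : ω.IsTranslationInvariant) (hρ : ω.density = n)
    (hme : ω.meanEnergy (hubbardTTPrimeFermionInteraction 1 0 U) 1 = energyDensityTT' 1 0 U n)
    {M : ℕ} (hM : 1 ≤ M) :
    (ω.expect (halfOpenBox 2 M) (etaRaise (fun w : PolySite (halfOpenBox 2 M) => siteStagger (ofLex w.1)) *
        etaLower (fun w : PolySite (halfOpenBox 2 M) => siteStagger (ofLex w.1)))).re / (M : ℝ) ^ 2 ≤
      4096 / (U * (1 - 2 * n) / (2 * (1 - n))) ^ 2 := by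
  have hn1 : n < 1 := by linarith
  have hn2 : n < 2 := by linarith
  have hgap := sub_two_mul_chemPotPlusTT'_ge_bathtub hU.le hn0 hn1
  have h1n : 0 < 2 * (1 - n) := by linarith
  have hmpos : 0 < U * (1 - 2 * n) / (2 * (1 - n)) := div_pos (mul_pos hU (by linarith)) h1n
  have h := etaPairing_boxStructureFactor_le_of_chemPotPlus_le (U := U) (n := n)
    (m := chemPotPlusTT' 1 0 U n) hU.le hn0 hn2 le_rfl (by linarith) hω hρ hme hM
  refine h.trans (div_le_div_of_nonneg_left (by norm_num) (by positivity) ?_)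
  exact pow_le_pow_left₀ hmpos.le hgap 2

/-! ### §3 QUARTER FILLING `n = 1/2`: every `U ≥ 0`, uniform margin `1.2251963` (kernel Fermi-sea row, `M = 64`) -/

/-- **`U − 2μ₊(1/2; U) ≥ 1.2251963` for EVERY `U ≥ 0`** (the `U`-terms cancel exactly at quarter filling; floor
`−1.3148398202 ≤ e(1,0,U,1/2)` = `fermiSeaCellRow_tPrime_zero_density_one_div_two`). [cite: LiebWuPhysicaA2003, §7]
[cite: LiebLoss1993, §8, Theorem 8.2] -/
theorem sub_two_mul_chemPotPlusTT'_quarterFilling_ge {U : ℝ} (hU : 0 ≤ U) :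
    (1.2251963 : ℝ) ≤ U - 2 * chemPotPlusTT' 1 0 U (1 / 2) := by
  have hℓ := fermiSeaCellRow_tPrime_zero_density_one_div_two hU
  have h := sub_two_mul_chemPotPlusTT'_ge_of_floor_decimal hU (n := 1 / 2) (by norm_num) (by norm_num) hℓ
  norm_num at h ⊢
  linarith

/-- **η-PAIRING ODLRO IS ABSENT AT QUARTER FILLING `(U, 1/2, 0)` FOR EVERY `U ≥ 0`**, with the `U`-UNIFORM bound
`Re ω(η†_Λ η_Λ) ≤ 64(|Λ'| − |Λ|)²/1.2251963²` and `M⁻⁴ Re ω(η†η) → 0`, for every translation-invariant ground state of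
density `1/2`. [cite: Yang1989, eqs. (6)–(8)] [cite: BratteliRobinsonII1997, Prop. 5.3.19] -/
theorem etaPairing_exclusion_quarterFilling {U : ℝ} (hU : 0 ≤ U)
    {ω : InfVolFermionState 2} (hω : ω.IsTranslationInvariant) (hρ : ω.density = 1 / 2)
    (hme : ω.meanEnergy (hubbardTTPrimeFermionInteraction 1 0 U) 1 = energyDensityTT' 1 0 U (1 / 2)) :
    Tendsto (fun M : ℕ =>
        (ω.expect (halfOpenBox 2 M) (etaRaise (fun w : PolySite (halfOpenBox 2 M) => siteStagger (ofLex w.1)) *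
          etaLower (fun w : PolySite (halfOpenBox 2 M) => siteStagger (ofLex w.1)))).re / (M : ℝ) ^ 4)
        atTop (𝓝 0) ∧
      ∀ {Λ Λ' : Finset (Site 2)}, Λ ⊆ Λ' → thicken Λ 1 ⊆ Λ' →
        (ω.expect Λ (etaRaise (fun w : PolySite Λ => siteStagger (ofLex w.1)) *
            etaLower (fun w : PolySite Λ => siteStagger (ofLex w.1)))).re ≤
          64 * ((#Λ' : ℝ) - #Λ) ^ 2 / (1.2251963 : ℝ) ^ 2 := by
  have hgap := sub_two_mul_chemPotPlusTT'_quarterFilling_ge hU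
  refine ⟨tendsto_etaPairing_boxLRO_of_chemPotPlus_lt hU (by norm_num) (by norm_num) (by linarith) hω hρ hme,
    fun hΛ h8 => ?_⟩
  have h := re_expect_etaRaise_mul_etaLower_le_of_chemPotPlus_le (U := U) (n := 1 / 2)
    (m := chemPotPlusTT' 1 0 U (1 / 2)) hU (by norm_num) (by norm_num) le_rfl (by linarith) hω hρ hme hΛ h8
  refine h.trans (div_le_div_of_nonneg_left (by positivity) (by positivity) ?_)
  exact pow_le_pow_left₀ (by norm_num) hgap 2

/-- **Quarter filling, structure factor**: `M⁻² Re ω(η†_{Λ_M} η_{Λ_M}) ≤ 4096/1.2251963² ≤ 2728.7` for every `U ≥ 0`,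
`M ≥ 1`. [cite: Yang1989, eq. (6)] [cite: BratteliRobinsonII1997, Prop. 5.3.19] -/
theorem etaPairing_boxStructureFactor_le_quarterFilling {U : ℝ} (hU : 0 ≤ U)
    {ω : InfVolFermionState 2} (hω : ω.IsTranslationInvariant) (hρ : ω.density = 1 / 2)
    (hme : ω.meanEnergy (hubbardTTPrimeFermionInteraction 1 0 U) 1 = energyDensityTT' 1 0 U (1 / 2))
    {M : ℕ} (hM : 1 ≤ M) :
    (ω.expect (halfOpenBox 2 M) (etaRaise (fun w : PolySite (halfOpenBox 2 M) => siteStagger (ofLex w.1)) *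
        etaLower (fun w : PolySite (halfOpenBox 2 M) => siteStagger (ofLex w.1)))).re / (M : ℝ) ^ 2 ≤
      (2728.7 : ℝ) := by
  have hgap := sub_two_mul_chemPotPlusTT'_quarterFilling_ge hU
  have h := etaPairing_boxStructureFactor_le_of_chemPotPlus_le (U := U) (n := 1 / 2)
    (m := chemPotPlusTT' 1 0 U (1 / 2)) hU (by norm_num) (by norm_num) le_rfl (by linarith) hω hρ hme hM
  refine h.trans ?_
  have hsq : (1.2251963 : ℝ) ^ 2 ≤ (U - 2 * chemPotPlusTT' 1 0 U (1 / 2)) ^ 2 := pow_le_pow_left₀ (by norm_num) hgap 2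
  have hpos : (0 : ℝ) < (1.2251963 : ℝ) ^ 2 := by norm_num
  calc (4096 : ℝ) / (U - 2 * chemPotPlusTT' 1 0 U (1 / 2)) ^ 2 ≤ 4096 / (1.2251963 : ℝ) ^ 2 :=
        div_le_div_of_nonneg_left (by norm_num) hpos hsq
    _ ≤ 2728.7 := by norm_num

end Summit.Ventures.CertifiedManyBodySolver.Observables

end
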